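import Literature.Analysis.FluidPDE.CP25PerturbationPicard
import Literature.Barriers.NavierStokesRegularity.InstantaneousTypeIBlowupBackground
import HarnessLib

/-!
# Cheskidov–Dai–Palasek 2025, Prop. 5.3 at the level of sup norms, in every dimension:
# the corrector `w` of the linearisation around `U^{1/N₀} + v` as a Picard fixed point

Eighth sibling proof file (all results proved; no definitions, no named facts) of the barrier
entry `Literature/Barriers/NavierStokesRegularity/InstantaneousTypeIBlowup` (A. Cheskidov, M. Dai,
S. Palasek, arXiv:2511.09556 (2025), Thm. 1.1). §5: "we construct the exact Navier–Stokes
solution as `u = U + v^{N₀} + w^{N₀}` with `w` a small corrector", solving (display before §5.1)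

  `∂ₜw - Δw + P∇·(w ⊗ w + 2(U^{1/N₀} + v) ⊙ w) = -P∇·f`,  `w|_{t=0} = 0`,

by "the semigroup theory and fixed point argument" (Prop. 5.2: the semigroup of the
linearisation; Prop. 5.3: `𝒯` is a contraction on `B_X(0,δ)`). The tree proves the
Coiculescu–Palasek version of this step (no background `U`) at the level of sup norms on a general
finite-dimensional inner product space `E` as `CP25Picard.exists_perturbation_fixedPoint`: a
measurable "background" `vt` with `‖vt(t)‖ ≤ ν(t)`, `√t ν(t) ≤ K₀`, a free term `g` with
`‖g(t)‖ ≤ g₀ t^{a-1/2}`, and the boundedness of the resolvent of the scalar Volterra majorant on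
the profile `t^{a-1/2}` (hypothesis `hR`) yield the corrector as a pointwise fixed point of the mild
map `w = g - B(vt,w) - B(w,vt) - B(w,w)` in the class `‖w(t)‖ ≤ g₀ C_R t^{a-1/2}`. For CDP the
background of the linearisation is the lift of `U(· + T_*) + v`, bounded by `C_U + ‖v(t)‖_∞`
(§5, first display: `C_U = sup_{n≤10} ‖∇ⁿU‖_∞ < ∞`), and the resolvent bound for the full majorant
`(C_U + ν) + s^{a-1/2}` is `tsum_iterate_volterraK_powProfile_background_le`
(`InstantaneousTypeIBlowupBackground`, from the Koch–Tataru bound `√s ν ≤ K₀` and the lacunary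
bound `∫(ν² + s^{-1/2}ν) ≤ C(1 + η log)` of Prop. 4.3, last display). This file assembles the two:

* `exists_corrector_fixedPoint_background` — **Prop. 5.3 (existence half) at the level of sup
  norms, every dimension**: for `0 < T ≤ 1`, `0 < a ≤ 1/2`, data `K₀, C, η, C_U`, measurable
  `vt` with `‖vt(t, y)‖ ≤ C_U + ν(t)` and `g` with `‖g(t, y)‖ ≤ g₀ t^{a-1/2}`, slope
  `(3θ̃ + 1)η ≤ a/2` and `g₀ C̃_R ≤ 1` (constants `θ̃`, `C̃_R` explicit in `C₀`,
  `K̃ = K₀ + C_U + 1`,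
  `C̃ = C(1+2C_U) + C_U² + 2C_U + (2(K₀+C_U)+1)/a + 1/(2a)`), there is a measurable `w` with
  `‖w(t, x)‖ ≤ g₀ C̃_R t^{a-1/2}`, `w = g - B(vt,w) - B(w,vt) - B(w,w)` pointwise on `(0,T] × E`,
  `w = 0` off `(0, T]`, inheriting every common period of `vt` and `g`.

What is NOT here (the rest of Prop. 5.3 and of clause (i)/(iv) of `h₃`): the `∇`/`C^{1,κ}` slot of
the `X`-norm, the identification of `g` with `𝒟[f + 2U⊙v]` and its bound from Prop. 4.3,
classicality of `u = U(·+T_*) + v + w` (Koch–Nadirashvili–Seregin–Šverák; the tree's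
`Torus.exists_isClassicalNSSolutionOn_of_oseenMild` is stated on `𝕋³` only), the pressure.

## References

* A. Cheskidov, M. Dai, S. Palasek, arXiv:2511.09556 (2025): §5 (the corrector equation, `C_U`),
  Props. 5.2–5.3 and their proofs. [`CheskidovDaiPalasek2025`]
* M. P. Coiculescu, S. Palasek, Invent. Math. 244 (2025), Props. 4.2–4.3 (the tree's
  `CP25PerturbationPicard`, `LacunaryVolterraResolvent`). [`CoiculescuPalasek2025`]
-/

noncomputable section

open MeasureTheory Set Filter Function
open scoped ENNReal

namespace Literature.Barriers.NavierStokesRegularity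

open Literature.Analysis.FluidPDE Literature.Analysis.FluidPDE.LacunaryVolterra

variable {E : Type*} [NormedAddCommGroup E] [InnerProductSpace ℝ E] [FiniteDimensional ℝ E]
  [MeasurableSpace E] [BorelSpace E]

/-- **Prop. 5.3 (existence of the corrector) at the level of sup norms, in every dimension.**
See the module docstring. The constants: `c = 2C₀` (`C₀ = C₀(E)` the slice constant of
`CP25Picard.exists_perturbation_fixedPoint`), `K̃ = K₀ + C_U + 1`,
`C̃ = (C(1+2C_U) + C_U² + 2C_U) + (2(K₀+C_U)+1)/a + 1/(2a)`, `θ̃ = c(1 + 2731c²K̃)C̃`,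
`C̃_R = 2/a + 4 + 2·3c(10K̃ + √2 C̃)e^{3θ̃}/a`.
[cite: CheskidovDaiPalasek2025, Prop. 5.3 and its proof (with Prop. 5.2)] -/
theorem exists_corrector_fixedPoint_background :
    ∃ C₀ : ℝ, 0 < C₀ ∧
    ∀ {T a K₀ C η CU g₀ : ℝ} {ν : ℝ → ℝ} {vt g : ℝ → E → E},
      0 < T → T ≤ 1 → 0 < a → a ≤ 1 / 2 → 0 ≤ K₀ → 0 ≤ η → 0 ≤ CU → 0 ≤ g₀ →
      Measurable ν → ContinuousOn ν (Ioc 0 T) → (∀ s ∈ Ioc 0 T, 0 ≤ ν s) →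
      (∀ s ∈ Ioc 0 T, Real.sqrt s * ν s ≤ K₀) →
      (∀ t₁ t₂ : ℝ, 0 < t₁ → t₁ ≤ t₂ → t₂ ≤ T →
        ∫ s in t₁..t₂, (ν s ^ 2 + s ^ (-(1 / 2 : ℝ)) * ν s) ≤ C * (1 + η * Real.log (t₂ / t₁))) →
      Measurable (uncurry vt) → Measurable (uncurry g) →
      (∀ t ∈ Ioc 0 T, ∀ y, ‖vt t y‖ ≤ CU + ν t) →
      (∀ t ∈ Ioc 0 T, ∀ y, ‖g t y‖ ≤ g₀ * t ^ (a - 1 / 2)) →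
      (3 * (2 * C₀ * (1 + 2731 * (2 * C₀) ^ 2 * (K₀ + CU + 1)) * ((C * (1 + 2 * CU) + CU ^ 2 +
          2 * CU) + (2 * (K₀ + CU) + 1) / a + 1 / (2 * a))) + 1) * η ≤ a / 2 →
      g₀ * (2 / a + 4 + 2 * (3 * (2 * C₀ * (10 * (K₀ + CU + 1) + Real.sqrt 2 * ((C * (1 + 2 *
          CU) + CU ^ 2 + 2 * CU) + (2 * (K₀ + CU) + 1) / a + 1 / (2 * a)))) * Real.exp (3 * (2 *
          C₀ * (1 + 2731 * (2 * C₀) ^ 2 * (K₀ + CU + 1)) * ((C * (1 + 2 * CU) + CU ^ 2 + 2 *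
          CU) + (2 * (K₀ + CU) + 1) / a + 1 / (2 * a))))) / a) ≤ 1 →
      ∃ w : ℝ → E → E, Measurable (uncurry w) ∧
        (∀ t ∈ Ioc 0 T, ∀ x, ‖w t x‖ ≤ g₀ * (2 / a + 4 + 2 * (3 * (2 * C₀ * (10 * (K₀ + CU + 1) +
            Real.sqrt 2 * ((C * (1 + 2 * CU) + CU ^ 2 + 2 * CU) + (2 * (K₀ + CU) + 1) / a +
            1 / (2 * a)))) * Real.exp (3 * (2 * C₀ * (1 + 2731 * (2 * C₀) ^ 2 * (K₀ + CU + 1)) *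
            ((C * (1 + 2 * CU) + CU ^ 2 + 2 * CU) + (2 * (K₀ + CU) + 1) / a + 1 / (2 *
            a))))) / a) * t ^ (a - 1 / 2)) ∧
        (∀ t ∈ Ioc 0 T, ∀ x, w t x = g t x - oseenDuhamel 1 0 vt w t x - oseenDuhamel 1 0 w vt t x -
          oseenDuhamel 1 0 w w t x) ∧
        (∀ t, t ∉ Ioc 0 T → ∀ x, w t x = 0) ∧
        (∀ h : E, (∀ t y, vt t (y + h) = vt t y) → (∀ t y, g t (y + h) = g t y) →
          ∀ t y, w t (y + h) = w t y) := by
  obtain ⟨C₀, hC₀, hP⟩ := CP25Picard.exists_perturbation_fixedPoint (E := E)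
  refine ⟨C₀, hC₀, ?_⟩
  intro T a K₀ C η CU g₀ ν vt g hT hT1 ha ha2 hK₀ hη hCU hg₀ hνm hνc hν0 h313a h313b hvtm hgm hvt hg
    hηs hsmall
  have hc : 0 < 2 * C₀ := by positivity
  have ha1 : a ≤ 1 := ha2.trans (by norm_num)
  -- ### the resolvent bound with background (Prop. 5.2), in the unfolded form of `hR`
  have hηs' : ((3 * (2 * C₀ * (1 + 2731 * (2 * C₀) ^ 2 * (K₀ + CU + 1)) * ((C * (1 + 2 * CU) +
      CU ^ 2 + 2 * CU) + (2 * (K₀ + CU) + 1) / a + 1 / (2 * a)))) + 1) * η ≤ a / 2 := hηs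
  have hR : ∀ t ∈ Ioc 0 T, ∑' n, ((fun (f : ℝ → ℝ≥0∞) (t : ℝ) => ∫⁻ s in Ioo 0 t,
      ENNReal.ofReal (2 * C₀ * (t - s) ^ (-(1 / 2 : ℝ)) * ((CU + ν s) + s ^ (a - 1 / 2))) *
          f s)^[n])
      (fun s => ENNReal.ofReal (s ^ (a - 1 / 2))) t ≤
      ENNReal.ofReal ((2 / a + 4 + 2 * (3 * (2 * C₀ * (10 * (K₀ + CU + 1) + Real.sqrt 2 * ((C *
          (1 + 2 * CU) + CU ^ 2 + 2 * CU) + (2 * (K₀ + CU) + 1) / a + 1 / (2 * a)))) *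
          Real.exp (3 * (2 * C₀ * (1 + 2731 * (2 * C₀) ^ 2 * (K₀ + CU + 1)) * ((C * (1 + 2 *
          CU) + CU ^ 2 + 2 * CU) + (2 * (K₀ + CU) + 1) / a + 1 / (2 * a))))) / a) *
          t ^ (a - 1 / 2)) := fun t ht =>
    tsum_iterate_volterraK_powProfile_background_le hc hK₀ hη hCU hT1 hνm hνc hν0 h313a h313b ha ha1
      hηs' ht
  -- ### the data of the Picard theorem for the majorant `C_U + ν`
  obtain ⟨hKT, -⟩ := volterraData_const_add hT1 hη hCU hνc hν0 h313a h313b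
  have hCR : 0 ≤ (2 / a + 4 + 2 * (3 * (2 * C₀ * (10 * (K₀ + CU + 1) + Real.sqrt 2 * ((C * (1 +
      2 * CU) + CU ^ 2 + 2 * CU) + (2 * (K₀ + CU) + 1) / a + 1 / (2 * a)))) * Real.exp (3 * (2 *
      C₀ * (1 + 2731 * (2 * C₀) ^ 2 * (K₀ + CU + 1)) * ((C * (1 + 2 * CU) + CU ^ 2 + 2 * CU) +
      (2 * (K₀ + CU) + 1) / a + 1 / (2 * a))))) / a) := by
    have h1 : 0 ≤ C := by
      have h := h313b T T hT le_rfl le_rfl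
      rw [intervalIntegral.integral_same, div_self hT.ne', Real.log_one, mul_zero, add_zero,
        mul_one] at h
      exact h
    positivity
  exact hP hT hT1 ha ha2 hg₀ hCR hsmall (measurable_const.add hνm)
    (fun s hs => add_nonneg hCU (hν0 s hs)) hKT hvtm hgm hvt hg hR

end Literature.Barriers.NavierStokesRegularity
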